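import Mathlib
import Summits.Ventures.HodgeRepro.Tier4.Line1.RTFSetting
import Summits.Ventures.HodgeRepro.Tier4.Line1.SpectralOfRTF
import Summits.Ventures.HodgeRepro.Tier4.Line1.RtfGeometric
import Summits.Ventures.HodgeRepro.Tier4.Line1.DefinedContentOfData
import Summits.Ventures.HodgeRepro.Tier4.Common.AdelicRTF
import Summits.Ventures.HodgeRepro.Tier4.Common.AdelicHaar
import Summits.Ventures.HodgeRepro.Tier4.Common.L1Convolution
import Summits.Ventures.HodgeRepro.Tier4.Line1.SecondCountableGA
import Summits.Ventures.HodgeRepro.Tier4.Line1.SigmaCompactGA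
import Summits.Ventures.HodgeRepro.Tier4.Common.CompactOpenLevel
import Summits.Ventures.HodgeRepro.Tier4.Common.PseudoCoeff
import Summits.Ventures.HodgeRepro.Tier4.Common.MixedPlaneCusp
import Summits.Ventures.HodgeRepro.Tier4.Line4.ConvProduct
import Summits.Ventures.HodgeRepro.Tier4.Line4.TorusProduct
import Summits.Ventures.HodgeRepro.Tier4.Line4.FinitePlacePositivity
import Summits.Ventures.HodgeRepro.Tier4.Line4.ProjectedSupport
import Summits.Ventures.HodgeRepro.Tier4.Line4.W3TwoVectorHit
import Summits.Ventures.HodgeRepro.Tier4.Line4.W3TwoVector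
import Summits.Ventures.HodgeRepro.Tier4.Line4.W4SpectralBridge
import Summits.Ventures.HodgeRepro.Tier4.Line4.GeometricBridge
import Summits.Ventures.HodgeRepro.Tier4.Line4.W3OfRieszType
import Summits.Ventures.HodgeRepro.Tier4.Line4.ConjStability
import Summits.Ventures.HodgeRepro.Tier4.Line4.AdmissibleOfONB
import Summits.Ventures.HodgeRepro.Tier4.Line4.LowestOfPseudoCoeff
import Summits.Ventures.HodgeRepro.Tier4.Line4.KTypeOfPeriodClosed
import Summits.Ventures.HodgeRepro.Tier4.Line4.ThetaRungs
import Summits.Ventures.HodgeRepro.Tier4.Line4.AdaptedONBConj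
import Summits.Ventures.HodgeRepro.Tier4.Line4.ConjSpanLemmas
import Summits.Ventures.HodgeRepro.Tier4.Line4.MaximalFamilyClosed

/-!
# Tier4/Line4 — v0.33 ASSEMBLY (work/v33/Assembly-v33.lean): the wall `mixed_two_torus_W3` FROM the §15 displays

Blind re-derivation cell `pub-hodge-repro`, Tier 4 «prove the step» (README §9–§10), seat t4-plan-4 (gen 4).  A
STATEMENTS + ASSEMBLY display, not a tree module (skeleton-class; never through the gate).  It carries the §15
statements file `L1Class-STATEMENTS.lean` (S14751) VERBATIM in Parts A–B and RE-CUTS Part C after the consumer read of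
the (d)-plate (2VEC-HIT p693015 `mixed_two_torus_W3_twoVector_hit`, ADM135 p693090, KTYPE p694119, LOWEST p694147,
B-L4-CONJ `mem_kTypeSpace'_conj`, `rightRegular_mem_kTypeSpace'`):

* **(7′) `IsArchCoeff` / `D3CoeffData`** — the archimedean factor `finf` is chosen FIRST (`∃ finf, ∀ ffin`): the
  pseudo-coefficient property is archimedean (`R(f) = R_∞(finf) ∘ R_f(ffin)` on an invariant `V`), so it holds for
  EVERY compactly supported finite factor; the clause is on `cj f` (= «`R(f)` kills the window constituents»), which is
  what LOWEST consumes through the conjugate transport `exists_conj_mem_of_hit`; the left `(T′_w, −e′)`-equivariance of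
  `cj finf` is the STABILITY input (`rightRegular_mem_kTypeSpace'` at `(−eP′, −eM′)` then `mem_kTypeSpace'_conj`).
* **(8′) `TailFamily` / `LevelTailDominated`** — the level family carries BOTH factors `ffin N`, `f₂ N` at level `N`
  (bi-`K(N)`-invariant; `f₂ N` a compactly supported test with the right `T′`-weights on the right), and the
  `γ₀`-term of `(finf ⊗ ffin N) ⋆ f₂ N` dominates the tail from some level on.
* **Layer A** (`twoVector_hit_L1`, `isAdmissibleS_span_conj_of_periods`): the `L¹` twin of 2VEC-HIT — `f₁ ∈ L¹`
  continuous, `f₂` compactly supported, `RtfSpectralL1` in place of `rtf_spectral`, `AdaptedClosedUnderL1` in place of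
  `IsInvariantSubspace.conv` on the `f₁`-side, `hJ` in the `S.J` form (no `Jc_eq_J`, whose proof is the finite
  unfolding) — and the assembly of `IsAdmissibleS` on the hit conjugate constituent from the two non-zero periods
  (KTYPE (4)/(6)), the pseudo-coefficients (LOWEST (5)/(7)), the adapted family (ADM135 (1)/(2)) and anisotropy (3).
* **Layer B** (`wall_of_L1_data`): the wall's conclusion on ANY plane `W` from the displayed §15 Props + the technical
  displays (`KTypeData`, `hnorm`, closedness of the constituents, anisotropy) — v0.33's example on `seesawPlane` is
  this theorem applied.

**v2 (05:25Z)** — after the crits' read of S14751: (0) `IsTestL1` is `Common.IsTestL1` by name (L1Convolution p697923) and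
`IsTestL1 (f₁ ⋆ f₂)` is `isTestL1_conv` by name (crit-1 PRECISION 2); (1) `PoincareSummable` is the UNIFORM-BOUND form
(α) of the lead's (R-12) ruling S14799 (the normal-convergence form is false on the indefinite instance, Entry 98);
(5) `TailDominated` carries the summability of the orbital family (crit-1 PRECISION 1), in the shape of L1-p4's
`exists_orbital_tail_lt_of_decay`; Part C re-cut as (7′)/(8′) above, with every field of `TailFamily` consumed.
Everything below `sorry`-free; the displays are the `def … : Prop`s and the binders of `wall_of_L1_data`.
Nothing here says anything about the status of the Hodge conjecture for CM abelian varieties, which is NOT proved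
(HC_CM is NOT proved by anyone in this repository).
-/

-- SPLIT NOTE (t4-L4-p1 g4, filing plan-4 g4's Assembly-v33.lean d979ecf30f9f712a · 666 on its word S14857 (d)): the gate's
-- ≤ 400-line lint for files with proofs forbids the single module, so the assembly is filed as TWO modules with every
-- declaration byte-identical to the assembly: this file = Part A (`section Abstract`) + Part C (`section Arch`);
-- `Tier4/Line4/L1ClassWall.lean` = Layer A + Layer B (imports this file; same namespace `Line4.L1Class`).

set_option autoImplicit false

noncomputable section
namespace Summit.Ventures.HodgeRepro.Tier4.Line4.L1Class

open MeasureTheory Topology NumberField Summit.Ventures.HodgeRepro.Tier4.Common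
  Summit.Ventures.HodgeRepro.Tier4.Line1 Summit.Ventures.HodgeRepro.Tier4.Line1.RTF

open scoped Pointwise

/-! ## Part A — C-L1-L1RTF: the `L¹` test functions and the two sides of the formula (abstract `Setting`) -/

section Abstract

variable {G : Type} [Group G] [TopologicalSpace G] [IsTopologicalGroup G] [MeasurableSpace G] [BorelSpace G]
  (S : Setting G)

/-! **(0)** the `L¹` test class is the tree's `Common.IsTestL1 S f := Continuous f ∧ Integrable f S.μ` (L1Convolution
p697923, typer-2 g4), with `isTestL1_of_isTest`, `IsTestL1.cj`, `isTestL1_conv` (`L¹ ⋆ C_c ⊆ L¹ ∩ C`) by name. -/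

/-- **(1) the POINCARÉ clause — UNIFORM-BOUND form (α)** (lead (R-12) S14799 on crit-1's objection S14790: the
normal-convergence form `∃ c summable, ‖f (x⁻¹ γ y)‖ ≤ c γ` is FALSE for `f₁ ⋆ f₂` on the indefinite realised setting,
Entry 98): on every pair of compacts the kernel series `∑_γ ‖f(x⁻¹ γ y)‖` converges POINTWISE and is bounded by one
constant `M` — exactly what the left-translate lattice count `#(Γ ∩ g C₂ C C₂⁻¹)` proves (plan-1 S14724 (2)), and all
that (2)'s Tonelli on `D_T × D_{T′}` needs (`∫∫ ∑_γ ‖f‖ ≤ M μ_T(D_T) μ_{T′}(D_{T′})`).  No junk: a summable non-negative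
family, the bound on its `tsum`. -/
def PoincareSummable (f : G → ℂ) : Prop :=
  ∀ C₁ C₂ : Set G, IsCompact C₁ → IsCompact C₂ →
    ∃ M : ℝ, ∀ x ∈ C₁, ∀ y ∈ C₂,
      Summable (fun γ : S.Gk => ‖f (x⁻¹ * γ * y)‖) ∧ ∑' γ : S.Gk, ‖f (x⁻¹ * γ * y)‖ ≤ M

/-- **(1′) the Poincaré clause is a THEOREM for `f₁ ⋆ f₂` with `f₁ ∈ L¹` and `f₂` of compact support** (plan-1 S14724 (2):
`‖K_{f₁⋆f₂}(x,y)‖ ≤ ‖f₁‖₁ · sup_h #{γ : h⁻¹ x⁻¹ γ y ∈ supp f₂}`, the lattice count uniformly bounded over `h ∈ G` because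
`G(k)\G` is compact: `g = γ′ c` with `c` in a compact fundamental set).  Owner: L1 (C-L1-L1RTF). -/
def PoincareOfConv : Prop :=
  ∀ f₁ f₂ : G → ℂ, IsTestL1 S f₁ → IsTest f₂ → PoincareSummable S (S.conv f₁ f₂)

/-- **(2) the geometric side for an `L¹` test**: `J(f) = ∑' o, O_o(f)` over ALL rational double cosets, the family
summable (Tonelli on the compact `D_T × D_{T′}` under the Poincaré domination; the finite sum `∑ᶠ` of `rtf_geometric`
becomes a `tsum`).  Owner: L1 (C-L1-L1RTF). -/
def RtfGeometricL1 : Prop :=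
  ∀ (χ : S.T → ℂ) (χ' : S.T' → ℂ), S.IsCharacter χ → S.IsCharacter' χ' →
    ∀ f : G → ℂ, IsTestL1 S f → PoincareSummable S f →
      Summable (fun o : S.Orbit => S.orbital χ χ' o f) ∧ S.J χ χ' f = ∑' o : S.Orbit, S.orbital χ χ' o f

/-- **(3) the spectral side with an `L¹` FIRST test** (`f₂` still of compact support): the SAME conclusion as the tree's
`rtf_spectral` (the `j`-th term is `specTerm` of `Line1.SpectralOfRTF`); `IsTest f₁` entered the compactly supported
proof only through `integrable_of_isTest`, the finite unfolding `∫_G = ∑_γ ∫_{γ D_G}` (now the countable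
`hasSum_integral_iUnion`) and Fubini for `R(f₁ ⋆ f₂) = R(f₁) ∘ R(f₂)`.  Owner: L1 (C-L1-L1RTF). -/
def RtfSpectralL1 : Prop :=
  ∀ (χ : S.T → ℂ) (χ' : S.T' → ℂ), S.IsCharacter χ → S.IsCharacter' χ' →
    ∀ (τ : ℕ → Set (G → ℂ)) (φ : ℕ → G → ℂ) (n : ℕ → ℕ), S.IsAdaptedONB τ φ n →
      ∀ f₁ f₂ : G → ℂ, IsTestL1 S f₁ → IsTest f₂ →
        HasSum (fun j => S.specTerm χ χ' φ f₁ f₂ j) (S.J χ χ' (S.conv f₁ f₂))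

/-- **C-L4-L1CLOSED (kernel-sized, LINE L4)**: the constituents of the adapted family are stable under `R(f)` for every
`L¹` test `f` (the tree's `IsInvariantSubspace.conv` is the compact-support clause; for a CLOSED constituent this is the
truncation argument `R(f) φ = lim R(f · 1_{C_n}) φ` in `L²(D_G)`).  A displayed clause of the family until typed. -/
def AdaptedClosedUnderL1 (τ : ℕ → Set (G → ℂ)) : Prop :=
  ∀ m, ∀ φ ∈ τ m, ∀ f : G → ℂ, IsTestL1 S f → S.R f φ ∈ τ m

/-- **L1.5 for an `L¹` first test** (proved; the tree's `atoms` with `AdaptedClosedUnderL1` in place of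
`IsInvariantSubspace.conv` on the `f₁`-side): a non-zero spectral term exhibits both toric functionals on one `τ m`,
and `R(f̄₁)` does not kill it. -/
theorem atoms_L1 {χ : S.T → ℂ} {χ' : S.T' → ℂ} {τ : ℕ → Set (G → ℂ)} {φ : ℕ → G → ℂ} {n : ℕ → ℕ}
    (hB : S.IsAdaptedONB τ φ n) (hcl : AdaptedClosedUnderL1 S τ) {f₁ f₂ : G → ℂ} (h₁ : IsTestL1 S f₁)
    (h₂ : IsTest f₂) (j : ℕ) (hj : S.specTerm χ χ' φ f₁ f₂ j ≠ 0) :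
    S.PeriodNonzeroT χ (τ (n j)) ∧ S.PeriodNonzeroT' χ' (τ (n j)) ∧ S.Hit (RTF.cj f₁) (τ (n j)) := by
  have hmem := hB.mem j
  have hinv := hB.inv (n j)
  have hT : S.periodT χ (fun t => S.R (RTF.cj f₁) (φ j) t) ≠ 0 := by
    intro h0
    apply hj
    unfold Setting.specTerm
    rw [h0]
    simp
  refine ⟨⟨S.R (RTF.cj f₁) (φ j), hcl (n j) _ hmem _ (h₁.cj S), hT⟩,
    ⟨S.R (RTF.refl f₂) (φ j), hinv.conv _ hmem _ h₂.refl, ?_⟩,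
    ⟨φ j, hmem, ?_⟩⟩
  · intro h0
    apply hj
    unfold Setting.specTerm
    rw [h0]
    simp
  · by_contra hall
    apply hT
    have hz : ∀ t : S.T, S.R (RTF.cj f₁) (φ j) t = 0 := fun t => by
      by_contra hne
      exact hall ⟨t, hne⟩
    unfold Setting.periodT
    simp [hz]

/-- **THE GENERIC ASSEMBLY THROUGH ONE NUMBER** (proved; plan-1 S14724 (1)): an adapted family, characters, an `L¹`
first test and a compactly supported second test with `J(f₁ ⋆ f₂) ≠ 0` produce a constituent HIT by `f̄₁` carrying BOTH
toric functionals — `exists_periods_of_isolation` with its geometric binders (`hconv`, `hiso`, `hne`) replaced by `hJ`. -/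
theorem exists_periods_of_J_ne_zero (hspec : RtfSpectralL1 S) {χ : S.T → ℂ} {χ' : S.T' → ℂ}
    (hχ : S.IsCharacter χ) (hχ' : S.IsCharacter' χ') {τ : ℕ → Set (G → ℂ)} {φ : ℕ → G → ℂ} {n : ℕ → ℕ}
    (hB : S.IsAdaptedONB τ φ n) (hcl : AdaptedClosedUnderL1 S τ) {f₁ f₂ : G → ℂ} (h₁ : IsTestL1 S f₁)
    (h₂ : IsTest f₂) (hJ : S.J χ χ' (S.conv f₁ f₂) ≠ 0) :
    ∃ m, S.PeriodNonzeroT χ (τ m) ∧ S.PeriodNonzeroT' χ' (τ m) ∧ S.Hit (RTF.cj f₁) (τ m) := by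
  obtain ⟨j, hj⟩ := exists_term_ne_zero (hspec χ χ' hχ hχ' τ φ n hB f₁ f₂ h₁ h₂) hJ
  exact ⟨n j, atoms_L1 S hB hcl h₁ h₂ j hj⟩

/-! ## Part B — C-L4-TAIL: the `o₀`-term dominates the tail -/

/-- **C-L4-TAIL shape** (plan-1 S14724 (2)): the orbital term of `o₀` is non-zero and strictly dominates the sum of all
the other rational double-coset terms.  For LINE L4 the test is the level family `f^{(N)} = f_{w₀} ⊗ f^{w₀}_N` and the
statement is asked for all `N ≥ N₀` (`TailDominatedFrom` below): coset sparsity at the finite places (`t(γ) ∈ t(γ₀) + NΛ`)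
against the archimedean decay `e^{−3 d(γ)}` of the weight-3 coefficient's orbital integral (Feigon–Whitehouse 2009 /
Ramakrishnan–Rogawski 2005, level-to-infinity isolation).  v2 (crit-1 PRECISION 1, S14790): the orbital family is
SUMMABLE — the clause the bare `tsum` would otherwise forfeit (junk `0` on a non-summable tail); this is the shape of
L1-p4 g4's `Setting.exists_orbital_tail_lt_of_decay` (TailAssembly p698331, S14820). -/
def TailDominated (χ : S.T → ℂ) (χ' : S.T' → ℂ) (o₀ : S.Orbit) (f : G → ℂ) : Prop :=
  S.orbital χ χ' o₀ f ≠ 0 ∧ Summable (fun o : S.Orbit => S.orbital χ χ' o f) ∧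
    ‖∑' o : {o : S.Orbit // o ≠ o₀}, S.orbital χ χ' o.1 f‖ < ‖S.orbital χ χ' o₀ f‖

/-- the level-family form: from some level on, the `o₀`-term dominates. -/
def TailDominatedFrom (χ : S.T → ℂ) (χ' : S.T' → ℂ) (o₀ : S.Orbit) (f : ℕ → G → ℂ) : Prop :=
  ∃ N₀ : ℕ, ∀ N ≥ N₀, TailDominated S χ χ' o₀ (f N)

omit [IsTopologicalGroup G] [BorelSpace G] in
/-- glue (proved): a summable family splits as the `o₀`-term plus the sum over `o ≠ o₀`. -/
theorem tsum_eq_add_tsum_ne {a : S.Orbit → ℂ} (ha : Summable a) (o₀ : S.Orbit) :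
    ∑' o, a o = a o₀ + ∑' o : {o : S.Orbit // o ≠ o₀}, a o.1 := by
  have h := ha.tsum_subtype_add_tsum_subtype_compl ({o₀} : Set S.Orbit)
  rw [← h, tsum_singleton]
  rfl

omit [IsTopologicalGroup G] [BorelSpace G] in
/-- **TAIL ⇒ `J ≠ 0`** (proved, 6 lines from `RtfGeometricL1`): `J = O_{o₀} + tail` and `‖tail‖ < ‖O_{o₀}‖`. -/
theorem J_ne_zero_of_tailDominated (hgeo : RtfGeometricL1 S) {χ : S.T → ℂ} {χ' : S.T' → ℂ}
    (hχ : S.IsCharacter χ) (hχ' : S.IsCharacter' χ') {f : G → ℂ} (hf : IsTestL1 S f) (hP : PoincareSummable S f)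
    {o₀ : S.Orbit} (hT : TailDominated S χ χ' o₀ f) : S.J χ χ' f ≠ 0 := by
  obtain ⟨hsum, hJ⟩ := hgeo χ χ' hχ hχ' f hf hP
  rw [hJ, tsum_eq_add_tsum_ne S hsum o₀]
  intro h0
  have h1 : S.orbital χ χ' o₀ f = -∑' o : {o : S.Orbit // o ≠ o₀}, S.orbital χ χ' o.1 f := by
    rw [eq_neg_iff_add_eq_zero]
    exact h0
  have h2 : ‖S.orbital χ χ' o₀ f‖ = ‖∑' o : {o : S.Orbit // o ≠ o₀}, S.orbital χ χ' o.1 f‖ := by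
    rw [h1, norm_neg]
  exact absurd h2 (ne_of_gt hT.2.2)

/-- **THE COMPOSITION** (proved): L1RTF (both sides + the Poincaré theorem) + L1CLOSED + TAIL ⇒ a constituent hit by
`f̄₁` with both toric functionals — the `L¹` replacement of `exists_periods_of_isolation`; v2: `IsTestL1 (f₁ ⋆ f₂)` is
typer-2's `isTestL1_conv` by name (crit-1 PRECISION 2). -/
theorem exists_periods_of_tail [SecondCountableTopology G] [SFinite S.μ] (hspec : RtfSpectralL1 S)
    (hgeo : RtfGeometricL1 S) (hPc : PoincareOfConv S)
    {χ : S.T → ℂ} {χ' : S.T' → ℂ} (hχ : S.IsCharacter χ) (hχ' : S.IsCharacter' χ') {τ : ℕ → Set (G → ℂ)}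
    {φ : ℕ → G → ℂ} {n : ℕ → ℕ} (hB : S.IsAdaptedONB τ φ n) (hcl : AdaptedClosedUnderL1 S τ) {f₁ f₂ : G → ℂ}
    (h₁ : IsTestL1 S f₁) (h₂ : IsTest f₂) {o₀ : S.Orbit}
    (hT : TailDominated S χ χ' o₀ (S.conv f₁ f₂)) :
    ∃ m, S.PeriodNonzeroT χ (τ m) ∧ S.PeriodNonzeroT' χ' (τ m) ∧ S.Hit (RTF.cj f₁) (τ m) :=
  exists_periods_of_J_ne_zero S hspec hχ hχ' hB hcl h₁ h₂
    (J_ne_zero_of_tailDominated S hgeo hχ hχ' (isTestL1_conv S h₁ h₂) (hPc f₁ f₂ h₁ h₂) hT)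

end Abstract


/-! ## Part C — C-L4-D3COEFF (7′) and C-L4-TAIL (8′), re-cut for the (d)-plate consumers -/

section Arch

variable {k : Type} [Field k] [NumberField k] (W : PlaneData k) [MeasurableSpace (GA W)] [BorelSpace (GA W)]

/-- the product `finf ⊗ ffin` of an archimedean and a finite factor, as a function on `G(𝔸)` (the `IsProductFn` shape of
ConvProduct p697081, written out). -/
def prodFn (finf ffin : GA W → ℂ) : GA W → ℂ := fun x => finf (GA.ofInfPart W x) * ffin (GA.ofFinPart W x)

omit [MeasurableSpace (GA W)] [BorelSpace (GA W)] in
/-- glue (proved): `prodFn` is a product function. -/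
theorem isProductFn_prodFn (finf ffin : GA W → ℂ) : IsProductFn W (prodFn W finf ffin) finf ffin := fun _ => rfl

omit [MeasurableSpace (GA W)] [BorelSpace (GA W)] in
/-- glue (proved): the product of continuous factors is continuous (`continuous_ofInfPart`, `continuous_ofFinPart`). -/
theorem continuous_prodFn {finf ffin : GA W → ℂ} (h₁ : Continuous finf) (h₂ : Continuous ffin) :
    Continuous (prodFn W finf ffin) :=
  (h₁.comp (continuous_ofInfPart W)).mul (h₂.comp (continuous_ofFinPart W))

/-- **the archimedean factor of the `γ₀`-term** — the `(χ, χ′)`-twisted integral of the archimedean factor over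
`T_∞ × T′_∞` (the `innerInf` of Integ-Concat-v2 Part 7 written out; L2-p1's FACTOR module when it lands by name). -/
def archFactor (R : RTFData W) (finf : GA W → ℂ) (γ₀ : GA W) (νinf : Measure (torusInf W))
    (νinf' : Measure (torusInf' W)) : ℂ :=
  ∫ a : torusInf W, R.chi a * (∫ a' : torusInf' W, starRingEnd ℂ (R.chi' a') *
    finf (((a : torusT W) : GA W)⁻¹ * γ₀ * ((a' : torusT' W) : GA W)) ∂νinf') ∂νinf

/-- **a compactly supported finite factor**: continuous, a function of the finite coordinate only, of compact support
on `G(𝔸_f)`. -/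
structure IsFinFactor (ffin : GA W → ℂ) : Prop where
  cont : Continuous ffin
  finOnly : ∀ x, ffin x = ffin (GA.ofFinPart W x)
  compact : HasCompactSupport (fun x : finitePart W => ffin (x : GA W))

/-- **C-L4-D3COEFF (7′) — the archimedean coefficient** `finf` (the weight-3 INTEGRABLE discrete-series matrix
coefficient at `w₀`, the `(eP′, eM′)`-weight coefficient of the compact `U(2)` at the definite places): continuous, a
function of the archimedean coordinate only, with
(i) a non-zero `γ₀`-term archimedean factor (`D₃(f_{w₀}) v ≠ 0` on the lowest-`K`-type vector, folded through the
    compact `T_{w₀} × T′_{w₀}`-integral as in §14″);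
(ii) the left `(T′_w, (−eP′ w, −eM′ w))`-equivariance of `cj finf` at every infinite place (the STABILITY input of
    `rightRegular_mem_kTypeSpace'` at `(−eP′, −eM′)`, transported by `mem_kTypeSpace'_conj`);
(iii) for EVERY compactly supported finite factor `ffin`: `finf ⊗ ffin` is integrable, and `R(finf ⊗ ffin)` kills every
    closed non-zero irreducible constituent carrying a `T_{w₀}`- resp. `T′_{w₀}`-weight in the window
    `|(e₊ − e₋) + 2j| < 3` (the operator form of Schur orthogonality for the integrable `D₃`: `π(f_{w₀}) = 0` for every
    irreducible unitary `π ≇ D₃`, Harish-Chandra `D_k ⊂ L¹ ⟺ k ≥ 3`; `R(f) = R_∞(finf) ∘ R_f(ffin)` on an invariant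
    `V`, so the finite factor is immaterial) — stated on `cj (finf ⊗ ffin)` because LOWEST consumes it through the
    conjugate transport `exists_conj_mem_of_hit`.
The real-analytic obstruction of §12.15 does not apply: `finf` has NO compact support at `w₀`. -/
structure IsArchCoeff (S : RTF.Setting (GA W)) (R : RTFData W) (q : QuadData k) (g g' : Matrix (Fin 4) (Fin 4) k)
    (w₀ : InfinitePlace k) (eP eM eP' eM' : InfinitePlace k → ℤ) (γ₀ : GA W) (νinf : Measure (torusInf W))
    (νinf' : Measure (torusInf' W)) (finf : GA W → ℂ) : Prop where
  cont : Continuous finf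
  infOnly : ∀ x, finf x = finf (GA.ofInfPart W x)
  arch_ne : archFactor W R finf γ₀ νinf νinf' ≠ 0
  equiv : ∀ (w : InfinitePlace k) (κ : GA W), κ ∈ localTorusAt' W w → ∀ y,
    RTF.cj finf (κ⁻¹ * y) =
      weightAt' W q w g g' 0 κ ^ (-eP' w) * weightAt' W q w g g' 1 κ ^ (-eM' w) * RTF.cj finf y
  integrable : ∀ ffin : GA W → ℂ, IsFinFactor W ffin → Integrable (prodFn W finf ffin) S.μ
  pseudo : ∀ ffin : GA W → ℂ, IsFinFactor W ffin →
    Common.IsPseudoCoeffAt W S q w₀ eP eM (RTF.cj (prodFn W finf ffin))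
  pseudo' : ∀ ffin : GA W → ℂ, IsFinFactor W ffin →
    Common.IsPseudoCoeffAt' W S q g g' w₀ eP' eM' (RTF.cj (prodFn W finf ffin))

/-- **C-L4-D3COEFF — the statement**: such a coefficient exists. -/
def D3CoeffData (S : RTF.Setting (GA W)) (R : RTFData W) (q : QuadData k) (g g' : Matrix (Fin 4) (Fin 4) k)
    (w₀ : InfinitePlace k) (eP eM eP' eM' : InfinitePlace k → ℤ) (γ₀ : GA W) (νinf : Measure (torusInf W))
    (νinf' : Measure (torusInf' W)) : Prop :=
  ∃ finf : GA W → ℂ, IsArchCoeff W S R q g g' w₀ eP eM eP' eM' γ₀ νinf νinf' finf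

omit [MeasurableSpace (GA W)] [BorelSpace (GA W)] in
/-- glue (proved): the left `(T′_w, −e′)`-equivariance of `cj (finf ⊗ ffin)` from that of `cj finf` — the finite factor
is untouched by `κ ∈ T′_w ⊂ G_∞` (`localTorusAt'_subset_infinitePart`, `ofInfPart_mul`, `ofFinPart_eq_one_of_mem_infinitePart`). -/
theorem cj_prodFn_equiv (q : QuadData k) (g g' : Matrix (Fin 4) (Fin 4) k) (eP' eM' : InfinitePlace k → ℤ)
    {finf : GA W → ℂ}
    (hequiv : ∀ (w : InfinitePlace k) (κ : GA W), κ ∈ localTorusAt' W w → ∀ y,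
      RTF.cj finf (κ⁻¹ * y) =
        weightAt' W q w g g' 0 κ ^ (-eP' w) * weightAt' W q w g g' 1 κ ^ (-eM' w) * RTF.cj finf y)
    (ffin : GA W → ℂ) (w : InfinitePlace k) (κ : GA W) (hκ : κ ∈ localTorusAt' W w) (y : GA W) :
    RTF.cj (prodFn W finf ffin) (κ⁻¹ * y) =
      weightAt' W q w g g' 0 κ ^ (-eP' w) * weightAt' W q w g g' 1 κ ^ (-eM' w) *
        RTF.cj (prodFn W finf ffin) y := by
  have hinf : κ ∈ infinitePart W := localTorusAt'_subset_infinitePart W w hκ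
  have h1 : GA.ofInfPart W (κ⁻¹ * y) = κ⁻¹ * GA.ofInfPart W y := by
    rw [ofInfPart_mul, ofInfPart_inv, ofInfPart_eq_self_of_mem_infinitePart W hinf]
  have h2 : GA.ofFinPart W (κ⁻¹ * y) = GA.ofFinPart W y := by
    rw [ofFinPart_mul, ofFinPart_inv, ofFinPart_eq_one_of_mem_infinitePart W hinf, inv_one, one_mul]
  have hq := hequiv w κ hκ (GA.ofInfPart W y)
  simp only [RTF.cj, prodFn, h1, h2, map_mul] at hq ⊢
  rw [hq]
  ring

omit [MeasurableSpace (GA W)] [BorelSpace (GA W)] in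
/-- glue (proved): the left `K(N)`-invariance of `cj (finf ⊗ ffin)` from the left `K(N)`-invariance of the finite
factor — the archimedean factor is untouched by `κ ∈ K(N) ⊂ G(𝔸_f)` (`levelK_le_finitePart`). -/
theorem cj_prodFn_levelInv {finf ffin : GA W → ℂ} (N : ℕ)
    (hleft : ∀ κ ∈ levelK W N, ∀ x, ffin (κ⁻¹ * x) = ffin x) (κ : GA W) (hκ : κ ∈ levelK W N) (y : GA W) :
    RTF.cj (prodFn W finf ffin) (κ⁻¹ * y) = RTF.cj (prodFn W finf ffin) y := by
  have hfin : κ ∈ finitePart W := levelK_le_finitePart W N hκ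
  have h1 : GA.ofInfPart W (κ⁻¹ * y) = GA.ofInfPart W y := by
    rw [ofInfPart_mul, ofInfPart_inv, ofInfPart_eq_one_of_mem_finitePart W hfin, inv_one, one_mul]
  have h2 : GA.ofFinPart W (κ⁻¹ * y) = κ⁻¹ * GA.ofFinPart W y := by
    rw [ofFinPart_mul, ofFinPart_inv, ofFinPart_eq_self_of_mem_finitePart W hfin]
  simp only [RTF.cj, prodFn, h1, h2, hleft κ hκ]

omit [MeasurableSpace (GA W)] [BorelSpace (GA W)] in
/-- glue (proved): the left `(T′_w, −e′)`-equivariance of `refl f₂` is the right `(T′_w, −e′)`-equivariance of `f₂`. -/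
theorem refl_equiv (q : QuadData k) (g g' : Matrix (Fin 4) (Fin 4) k) (eP' eM' : InfinitePlace k → ℤ)
    {f₂ : GA W → ℂ}
    (hequiv : ∀ (w : InfinitePlace k) (κ : GA W), κ ∈ localTorusAt' W w → ∀ x,
      f₂ (x * κ) = weightAt' W q w g g' 0 κ ^ (-eP' w) * weightAt' W q w g g' 1 κ ^ (-eM' w) * f₂ x)
    (w : InfinitePlace k) (κ : GA W) (hκ : κ ∈ localTorusAt' W w) (y : GA W) :
    RTF.refl f₂ (κ⁻¹ * y) =
      weightAt' W q w g g' 0 κ ^ (-eP' w) * weightAt' W q w g g' 1 κ ^ (-eM' w) * RTF.refl f₂ y := by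
  simp only [RTF.refl, mul_inv_rev, inv_inv]
  exact hequiv w κ hκ y⁻¹

omit [MeasurableSpace (GA W)] [BorelSpace (GA W)] in
/-- glue (proved): the left `K`-invariance of `refl f₂` is the right `K`-invariance of `f₂`. -/
theorem refl_levelInv {f₂ : GA W → ℂ} (K : Subgroup (GA W)) (hright : ∀ κ ∈ K, ∀ x, f₂ (x * κ) = f₂ x)
    (κ : GA W) (hκ : κ ∈ K) (y : GA W) : RTF.refl f₂ (κ⁻¹ * y) = RTF.refl f₂ y := by
  simp only [RTF.refl, mul_inv_rev, inv_inv]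
  exact hright κ hκ y⁻¹

/-- **C-L4-TAIL (8′) — the level family**: at every level `N` a finite factor `ffin N` (continuous, compactly supported,
a function of the finite coordinate, left `K(N)`-invariant — the intended witness is the indicator of the double
coset `K(N) γ₀ K(N)`) and a second test `f₂ N` (continuous of compact support, right `K(N)`-invariant, of right
`(T′_w, −e′)`-weights at every infinite place).  EVERY field is consumed by the assembly (through `cj_prodFn_equiv`,
`cj_prodFn_levelInv`, `refl_equiv`, `refl_levelInv`); the support and bi-invariance of the intended witness are not
displayed because nothing on the wall's path reads them. -/
structure TailFamily (q : QuadData k) (g g' : Matrix (Fin 4) (Fin 4) k) (eP' eM' : InfinitePlace k → ℤ)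
    (ffin f₂ : ℕ → GA W → ℂ) : Prop where
  fin : ∀ N, IsFinFactor W (ffin N)
  leftInv : ∀ N, ∀ κ ∈ levelK W N, ∀ x, ffin N (κ⁻¹ * x) = ffin N x
  test₂ : ∀ N, IsTestFn W (f₂ N)
  equiv₂ : ∀ N (w : InfinitePlace k) (κ : GA W), κ ∈ localTorusAt' W w → ∀ x,
    f₂ N (x * κ) = weightAt' W q w g g' 0 κ ^ (-eP' w) * weightAt' W q w g g' 1 κ ^ (-eM' w) * f₂ N x
  rightInv₂ : ∀ N, ∀ κ ∈ levelK W N, ∀ x, f₂ N (x * κ) = f₂ N x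

/-- **C-L4-TAIL — the statement on the family**: from some level on, the `o₀`-term of `(finf ⊗ ffin N) ⋆ f₂ N` is
non-zero and dominates the sum of all other rational double-coset terms (`o₀ = S.orbitOf γ₀` on
`Setting.ofAdelicData`; a parameter here, `S.Gk` being generic).  The one genuinely analytic step of the line after
§15: coset sparsity `t(γ) ∈ t(γ₀) + NΛ` at the finite places against the archimedean decay of the weight-3 orbital
integrals (Feigon–Whitehouse 2009 / Ramakrishnan–Rogawski 2005, level-to-infinity isolation). -/
def LevelTailDominated (S : RTF.Setting (GA W)) (χ : S.T → ℂ) (χ' : S.T' → ℂ) (o₀ : S.Orbit) (finf : GA W → ℂ)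
    (ffin f₂ : ℕ → GA W → ℂ) : Prop :=
  TailDominatedFrom S χ χ' o₀ (fun N => S.conv (prodFn W finf (ffin N)) (f₂ N))

end Arch

end Summit.Ventures.HodgeRepro.Tier4.Line4.L1Class

end
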